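/-
Copyright (c) 2026 the pub-hodgecm-mathlib formalisation cell (harness21).  Prover seat hodgecm-mathlib-K2E4-p07 (g3), Track B «K2-LIT» ∕ h413
(stmt-HodgeConjecture-24833, supports-only), ROAD R3 «RANK-ONE MASS» for ‹J3› v2, letter (D-a) «DOCK BLOCK MODEL» (K2E3-p15 (g3) re-cut 02:03:48Z,
deal 02:07:40Z; head `K2/K2E3-p15/g3/HEADS-letterD.K2E3-p15-g3.lean` 8d2cc3ad :29 VERBATIM).  2026-09-04.
-/
import Summits.HodgeConjecture.HodgeConjecture.Theorems.K2E3CompactSheetBlockModel   -- ★ p856521 (this seat, R3g): `blocks_of_twistGram_eq_finSum`, `not_exists_uniformizer_eq_norm`; kit ★ p856451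
import Summits.HodgeConjecture.HodgeConjecture.Theorems.K2E3DockInvariantForm       -- ★ F3a p856517 (K2E4-p13): `exists_formCongr_dock_eq` (`ᵗσy·H′_v·y = (0 0 λ; 0 μ 0; λ 0 0)`)
import Literature.NumberTheory.Rogawski1990.LocalNormFibreBlockDichotomyDock         -- ★ `coe_endoEmbLocal_eq_swap_mul_finSum_mul_swap` (`ι_v(h) = W (h.1 ⊕ᶠ h.2) W`)
import Literature.NumberTheory.Rogawski1990.KottwitzSignTwistedPlane                 -- ★ `finSum_two_one_eq` (`B ⊕ᶠ C` in coordinates)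
import HarnessLib

/-!
# ‹S› road J ∕ R3 — letter (D-a) «DOCK BLOCK MODEL»: the first class `ε` of the dock in block coordinates

Sub-problem `HodgeConjecture` of summit `HodgeConjecture`; item h413 = stmt-HodgeConjecture-24833 (supports-only); namespace
`Summit.HodgeConjecture.HodgeConjecture.Cruxes.H413.K2E3DockBlockModelInert`.

THE SITUATION (‹J3› v2 at an inert unramified place `v ∤ 2`, notation of the (u) assembly).  `H_v = U(Φ₂)_v × U(Φ₁)_v` is docked into `U(H′)_v` by
`θ : H_v ≃ₜ* Z(ε)` with an explicit conjugator `y ∈ GL₃(L ⊗ L⁺_v)`: `↑(θ z) = y · ι_v(z) · y⁻¹` (`ι_v` the printed pattern `(a 0 b; 0 u 0; c 0 d)`), and `ε = θ(εH)`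
for the block-scalar `εH = (a·1₂, u)`, `u ≠ a`.

THE THEOREM **`exists_blockModel_dock`** (K2E3-p15 (g3)'s frozen head, token for token): there are non-zero TOTALLY REAL scalars `c₂, c₁ ∈ L⁺` and a frame
`T ∈ GL₃(L ⊗ L⁺_v)` with `ᵗ(σT)·H′_v·T = 1 • (c₂Φ₂ ⊕ᶠ c₁Φ₁)_v` — so `φ_T := cmDatumLocalCongr T : U(c₂Φ₂ ⊕ᶠ c₁Φ₁)_v ≃ₜ* U(H′)_v` — a point `x` of the
block model with `mat x = a·1₂ ⊕ᶠ u·1₁`, `IsUnit (a − u)`, `φ_T x = ε`, and the INTERTWINING: every `g` of the model whose matrix is `mat z.1 ⊕ᶠ mat z.2` is carried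
to `↑(θ z)`.

THE PROOF (R3g's pattern ★ p856521, for the FIRST class and the conjugator `y` itself).
1. ★ F3a `exists_formCongr_dock_eq`: `ᵗ(σy)·H′_v·y = (0 0 λ; 0 μ 0; λ 0 0)` with `σλ = λ`, `σμ = μ`; after the coordinate swap `W` (`2 ↔ 3`):
   `ᵗσ(yW)·H′_v·(yW) = (λΦ₂) ⊕ᶠ (μ)`; ★ `blocks_of_twistGram_eq_finSum` makes `λ, μ` units.
2. NORM DICHOTOMY (local norm index two at an unramified non-split place: ★ `exists_norm_mul_of_not_exists_norm`, ★ `not_exists_uniformizer_eq_norm`, the global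
   uniformizer ★ `exists_global_uniformizer`): a `σ`-fixed unit `t` is `σ(s)⁻¹·ι(c)·s⁻¹` for a unit `s` and a GLOBAL real `c ∈ {1, ξ}` — `exists_unit_smul_eq_algebraMap`.
   Apply it to `λ` (`s₂, c₂`) and `μ` (`s₁, c₁`).
3. `S := (s₂·1₂) ⊕ᶠ (s₁·1₁)`, `T := y·W·S`: `ᵗ(σT)·H′_v·T = (σs₂·λ·s₂)Φ₂ ⊕ᶠ (σs₁·μ·s₁) = ι(c₂)Φ₂ ⊕ᶠ ι(c₁) = 1 • (c₂Φ₂ ⊕ᶠ c₁Φ₁)_v` (★ kit `formCongr_mul_of_finSum`).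
4. `x := φ_T⁻¹ ε`: `mat x = S⁻¹·W·(y⁻¹ ε y)·W·S = S⁻¹·W·ι(εH)·W·S = S⁻¹·(a·1 ⊕ᶠ u)·S = a·1 ⊕ᶠ u` (`ε = y ι(εH) y⁻¹` by `hε`, `hθ`; ★ swap lemma; ★ kit
   `finSum_inv_mul_scalar_mul`).
5. Intertwining: `T·(mat z.1 ⊕ᶠ mat z.2)·T⁻¹ = y·W·S·(z.1 ⊕ᶠ z.2)·S⁻¹·W·y⁻¹ = y·W·(z.1 ⊕ᶠ z.2)·W·y⁻¹ = y·ι(z)·y⁻¹ = ↑(θ z)` (`S` is block-scalar, hence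
   commutes with every `z.1 ⊕ᶠ z.2`).
6. `IsUnit (a − u)`: `L ⊗ L⁺_v = L_w` is a field at the non-split `w` (★ `LocalRing.isField_of_smul_eq`).

[cite: Rogawski1990, §4.8 Case (a) p. 53; §3.8 Prop. 3.8.1 p. 30] [cite: PlatonovRapinchuk1994, §2.3, §6.2] [cite: Omeara1963, §63C Example 63:16]
-/

set_option autoImplicit false

noncomputable section

open NumberField IsDedekindDomain Matrix
open Literature.NumberTheory.Automorphic Literature.NumberTheory.Automorphic.UnitaryGroup Literature.NumberTheory.GaloisRepresentations
open Literature.NumberTheory.Rogawski1990 Literature.NumberTheory.Weil1982.UnitaryFinTopForm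
open Summit.HodgeConjecture.HodgeConjecture.Cruxes.H413.K2E3CompactSheetBlockModelKit
open Summit.HodgeConjecture.HodgeConjecture.Cruxes.H413.K2E3CompactSheetBlockModel
open scoped MatrixGroups Matrix

namespace Summit.HodgeConjecture.HodgeConjecture.Cruxes.H413.K2E3DockBlockModelInert

set_option linter.dupNamespace false

/-! ## §1 Matrix lemmas: the swap `W`, block-scalar units, scalar congruences -/

section Matrices

variable {R : Type*} [CommRing R] (σ : R →+* R)

/-- The coordinate swap `2 ↔ 3` is an involution. [folklore] -/
theorem swap_mul_swap : !![(1 : R), 0, 0; 0, 0, 1; 0, 1, 0] * !![(1 : R), 0, 0; 0, 0, 1; 0, 1, 0] = 1 := by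
  ext i j
  fin_cases i <;> fin_cases j <;> simp [Matrix.mul_apply, Fin.sum_univ_three]

/-- The coordinate swap `2 ↔ 3` as a unit `W` with `W⁻¹ = W`. [folklore] -/
theorem exists_units_swap : ∃ W : GL (Fin 3) R, W.val = !![(1 : R), 0, 0; 0, 0, 1; 0, 1, 0] ∧ (W⁻¹).val = !![(1 : R), 0, 0; 0, 0, 1; 0, 1, 0] :=
  ⟨⟨_, _, swap_mul_swap, swap_mul_swap⟩, rfl, rfl⟩

/-- **The swap conjugates the dock Gram matrix to block form**: `ᵗ(σW)·(0 0 λ; 0 μ 0; λ 0 0)·W = (λΦ₂) ⊕ᶠ (μ)` written out. [cite: Rogawski1990, §4.8 Case (a) p. 53] -/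
theorem swap_conj_dockGram (lam mu : R) :
    ((!![(1 : R), 0, 0; 0, 0, 1; 0, 1, 0]).map σ)ᵀ * !![0, 0, lam; 0, mu, 0; lam, 0, 0] * !![(1 : R), 0, 0; 0, 0, 1; 0, 1, 0] =
      finSum 2 1 !![0, lam; lam, 0] !![mu] := by
  rw [Literature.NumberTheory.Rogawski1990.finSum_two_one_eq]
  ext i j
  fin_cases i <;> fin_cases j <;> simp [Matrix.mul_apply, Fin.sum_univ_three]

/-- **A scalar unit block** `s·1ₙ ∈ GLₙ(R)` with inverse `s′·1ₙ` (`s s′ = 1`). [cite: PlatonovRapinchuk1994, §2.3] -/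
theorem exists_gl_val_eq_smul_one (n : ℕ) {s : R} (hs : IsUnit s) :
    ∃ (S : GL (Fin n) R) (s' : R), s * s' = 1 ∧ S.val = s • (1 : Matrix (Fin n) (Fin n) R) ∧ (S⁻¹).val = s' • (1 : Matrix (Fin n) (Fin n) R) := by
  obtain ⟨su, rfl⟩ := hs
  refine ⟨⟨(su : R) • (1 : Matrix (Fin n) (Fin n) R), ((su⁻¹ : Rˣ) : R) • (1 : Matrix (Fin n) (Fin n) R), ?_, ?_⟩, ((su⁻¹ : Rˣ) : R), su.mul_inv, rfl, rfl⟩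
  · rw [Matrix.smul_mul, Matrix.one_mul, smul_smul, Units.mul_inv, one_smul]
  · rw [Matrix.smul_mul, Matrix.one_mul, smul_smul, Units.inv_mul, one_smul]

/-- **Scalar congruence**: `ᵗσ(s·1)·G·(s·1) = (σ(s)·s)·G`. [cite: PlatonovRapinchuk1994, §2.3] -/
theorem formCongr_of_val_eq_smul_one {n : ℕ} (S : GL (Fin n) R) {s : R} (hS : S.val = s • (1 : Matrix (Fin n) (Fin n) R)) (G : Matrix (Fin n) (Fin n) R) :
    formCongr σ S G = (σ s * s) • G := by
  have hmap : (s • (1 : Matrix (Fin n) (Fin n) R)).map σ = σ s • (1 : Matrix (Fin n) (Fin n) R) := by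
    ext i j
    by_cases hij : i = j
    · subst hij; simp
    · simp [Matrix.one_apply_ne hij]
  have h1 : formCongr σ S G = ((S.val).map σ)ᵀ * G * S.val := rfl
  rw [h1, hS, hmap, Matrix.transpose_smul, Matrix.transpose_one, Matrix.smul_mul, Matrix.one_mul, Matrix.smul_mul, Matrix.mul_smul, Matrix.mul_one,
    smul_smul]

/-- **Block-scalar units commute with block matrices**: `((s₂·1) ⊕ᶠ (s₁·1)) · (A ⊕ᶠ B) · ((s₂′·1) ⊕ᶠ (s₁′·1)) = A ⊕ᶠ B` for `s₂s₂′ = s₁s₁′ = 1`. [cite: PlatonovRapinchuk1994, §2.3] -/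
theorem finSum_smul_one_mul_finSum_mul {s₂ s₂' s₁ s₁' : R} (h₂ : s₂ * s₂' = 1) (h₁ : s₁ * s₁' = 1) (A : Matrix (Fin 2) (Fin 2) R) (B : Matrix (Fin 1) (Fin 1) R) :
    finSum 2 1 (s₂ • (1 : Matrix (Fin 2) (Fin 2) R)) (s₁ • (1 : Matrix (Fin 1) (Fin 1) R)) * finSum 2 1 A B *
        finSum 2 1 (s₂' • (1 : Matrix (Fin 2) (Fin 2) R)) (s₁' • (1 : Matrix (Fin 1) (Fin 1) R)) = finSum 2 1 A B := by
  rw [finSum_mul_finSum, finSum_mul_finSum, finSum_inj]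
  constructor
  · rw [Matrix.smul_mul, Matrix.one_mul, Matrix.smul_mul, Matrix.mul_smul, Matrix.mul_one, smul_smul, h₂, one_smul]
  · rw [Matrix.smul_mul, Matrix.one_mul, Matrix.smul_mul, Matrix.mul_smul, Matrix.mul_one, smul_smul, h₁, one_smul]

end Matrices

/-! ## §2 The norm dichotomy: a `σ`-fixed local unit is a GLOBAL real scalar up to a norm -/

section NormDichotomy

variable (L : Type) [Field L] [NumberField L] [IsCMField L] (v : HeightOneSpectrum (𝓞 ↥(maximalRealSubfield L)))
  (w : PlacesOver L v) (hw : IsCMField.complexConj L • w.1 = w.1) (hunr : Algebra.IsUnramifiedIn (𝓞 L) v.asIdeal)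

include hw hunr in
/-- **NORM DICHOTOMY at an unramified non-split place** (local norm index two): a `σ`-fixed unit `t ∈ L ⊗ L⁺_v = L_w` is `σ(s)·t·s = ι(c)` for a local unit `s` and a
non-zero `complexConj`-fixed GLOBAL scalar `c` — namely `c = 1` if `t` is a norm, else `c = ξ` the global uniformizer (`t = N(z)·ϖ_v`, ★ `exists_norm_mul_of_not_exists_norm`,
★ `not_exists_uniformizer_eq_norm`, ★ `exists_global_uniformizer`). [cite: Omeara1963, §63C Example 63:16] [cite: NeukirchANT1999, Ch. II §6] -/
theorem exists_unit_smul_eq_algebraMap {t : LocalRing L v} (htσ : conjLocal L (IsCMField.complexConj L) v t = t) (htu : IsUnit t) :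
    ∃ (s : LocalRing L v) (c : L), IsUnit s ∧ c ≠ 0 ∧ IsCMField.complexConj L c = c ∧
      algebraMap L (LocalRing L v) c = conjLocal L (IsCMField.complexConj L) v s * t * s := by
  set σ := conjLocal L (IsCMField.complexConj L) v with hσdef
  obtain ⟨x₀, hx₀⟩ := Literature.NumberTheory.NumberFields.IsCMField.exists_complexConj_ne L
  set δ : L := x₀ - IsCMField.complexConj L x₀ with hδdef
  have hcδ : IsCMField.complexConj L δ = -δ := by rw [hδdef, map_sub, IsCMField.complexConj_apply_apply, neg_sub]
  have hδ : δ ≠ 0 := fun h => hx₀ (sub_eq_zero.1 h).symm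
  set ϖ : LocalRing L v := toLocalRing L v (HeckeCharacter.uniformizer ↥(maximalRealSubfield L) v : v.adicCompletion ↥(maximalRealSubfield L)) with hϖdef
  have hϖu : IsUnit ϖ := isUnit_toLocalRing_uniformizer L v
  have hϖσ : σ ϖ = ϖ := by rw [hσdef, hϖdef, conjLocal_toLocalRing]
  have hϖnn := not_exists_uniformizer_eq_norm L v w hw hunr
  obtain ⟨ξ, hξc, hξloc, hξv, -⟩ := exists_global_uniformizer L v w hunr
  by_cases ht : ∃ z : LocalRing L v, IsUnit z ∧ t = σ z * z
  · obtain ⟨z, hzu, hz⟩ := ht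
    refine ⟨↑(hzu.unit⁻¹), 1, (hzu.unit⁻¹).isUnit, one_ne_zero, map_one _, ?_⟩
    have h3 : z * ↑(hzu.unit⁻¹) = 1 := hzu.mul_val_inv
    have h4 : σ z * σ ↑(hzu.unit⁻¹) = 1 := by rw [← map_mul, h3, map_one]
    rw [map_one, hz]
    have e : σ ↑(hzu.unit⁻¹) * (σ z * z) * ↑(hzu.unit⁻¹) = (σ z * σ ↑(hzu.unit⁻¹)) * (z * ↑(hzu.unit⁻¹)) := by ring
    rw [e, h3, h4, mul_one]
  · obtain ⟨z, hzu, hz⟩ := exists_norm_mul_of_not_exists_norm L v (IsCMField.complexConj L) hcδ hδ w hw hϖσ hϖu htσ htu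
      (fun ⟨z, hz, h⟩ => hϖnn ⟨z, hz, h⟩) ht
    have hξ0 : ξ ≠ 0 := by
      intro h0; rw [h0, map_zero, map_zero] at hξv; exact WithZero.zero_ne_coe hξv
    refine ⟨↑(hzu.unit⁻¹), ξ, (hzu.unit⁻¹).isUnit, hξ0, hξc, ?_⟩
    have h3 : z * ↑(hzu.unit⁻¹) = 1 := hzu.mul_val_inv
    have h4 : σ z * σ ↑(hzu.unit⁻¹) = 1 := by rw [← map_mul, h3, map_one]
    rw [hξloc, ← hϖdef, hz]
    have e : σ ↑(hzu.unit⁻¹) * (σ z * z * ϖ) * ↑(hzu.unit⁻¹) = ϖ * ((σ z * σ ↑(hzu.unit⁻¹)) * (z * ↑(hzu.unit⁻¹))) := by ring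
    rw [e, h3, h4, mul_one, mul_one]

end NormDichotomy

/-! ## §3 The dock block model -/

set_option maxHeartbeats 400000 in -- the final defeq bookkeeping `Fin 3 = Fin (2 + 1)` of the head's mixed carriers
/-- **(D-a) DOCK BLOCK MODEL** (K2E3-p15 (g3)'s head `HEADS-letterD` :29, token for token).  For the dock `θ : H_v ≃ₜ* Z(ε)`, `↑(θ z) = y·ι_v(z)·y⁻¹`, `ε = θ(εH)`,
`εH = (a·1₂, u)` with `u ≠ a`, at an inert unramified place: non-zero real `c₂, c₁ ∈ L`, a frame `T` with `ᵗ(σT)·H′_v·T = 1 • (c₂Φ₂ ⊕ᶠ c₁Φ₁)_v`, a block-scalar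
point `x` of the model `U(c₂Φ₂ ⊕ᶠ c₁Φ₁)_v` (`mat x = a·1 ⊕ᶠ u·1`, `IsUnit (a − u)`) with `φ_T x = ε`, and the intertwining `φ_T g = ↑(θ z)` whenever `mat g = mat z.1 ⊕ᶠ mat z.2`.
[cite: Rogawski1990, §4.8 Case (a) p. 53; §3.8 Prop. 3.8.1 p. 30] [cite: PlatonovRapinchuk1994, §2.3, §6.2] -/
theorem exists_blockModel_dock (L : Type) [Field L] [NumberField L] [IsCMField L] (H' : Matrix (Fin 3) (Fin 3) L)
    (hherm : (H'.map (cmConjRingHom L))ᵀ = H') (hanis : ∀ x : Fin 3 → L, Literature.AlgebraicGeometry.ShimuraVarieties.hermForm (cmConjRingHom L) H' x x = 0 → x = 0)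
    (v : HeightOneSpectrum (𝓞 ↥(maximalRealSubfield L))) (w : PlacesOver L v) (hw : IsCMField.complexConj L • w.1 = w.1)
    (hunr : Algebra.IsUnramifiedIn (𝓞 L) v.asIdeal)
    (εH : ((cmDatum L 2 (Matrix.of fun i j : Fin 2 => if i.val + j.val + 1 = 2 then (1 : L) else 0)).Local v ×
      (cmDatum L 1 (Matrix.of fun i j : Fin 1 => if i.val + j.val + 1 = 1 then (1 : L) else 0)).Local v)) (a : LocalRing L v)
    (ha : (εH.1.val.val : Matrix (Fin 2) (Fin 2) (LocalRing L v)) = a • (1 : Matrix (Fin 2) (Fin 2) (LocalRing L v)))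
    (hu : (εH.2.val.val : Matrix (Fin 1) (Fin 1) (LocalRing L v)) 0 0 ≠ a)
    {ε : (cmDatum L 3 H').Local v} {y : GL (Fin 3) (LocalRing L v)}
    (θ : ((cmDatum L 2 (Matrix.of fun i j : Fin 2 => if i.val + j.val + 1 = 2 then (1 : L) else 0)).Local v ×
      (cmDatum L 1 (Matrix.of fun i j : Fin 1 => if i.val + j.val + 1 = 1 then (1 : L) else 0)).Local v) ≃ₜ* ↥(Subgroup.centralizer ({ε} : Set ((cmDatum L 3 H').Local v))))
    (hε : (θ εH).1 = ε)
    (hθ : ∀ z : ((cmDatum L 2 (Matrix.of fun i j : Fin 2 => if i.val + j.val + 1 = 2 then (1 : L) else 0)).Local v ×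
      (cmDatum L 1 (Matrix.of fun i j : Fin 1 => if i.val + j.val + 1 = 1 then (1 : L) else 0)).Local v),
      (((θ z).1).val : GL (Fin 3) (LocalRing L v)) = y * ((endoEmbLocal L v z).val : GL (Fin 3) (LocalRing L v)) * y⁻¹) :
    ∃ (c₂ c₁ : L), c₂ ≠ 0 ∧ c₁ ≠ 0 ∧ IsCMField.complexConj L c₂ = c₂ ∧ IsCMField.complexConj L c₁ = c₁ ∧
      ∃ (T : GL (Fin (2 + 1)) (LocalRing L v))
        (hT : formCongr (conjLocal L (IsCMField.complexConj L) v) T (H'.map (algebraMap L (LocalRing L v))) =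
          (1 : LocalRing L v) • (finSum 2 1 (c₂ • (Matrix.of fun i j : Fin 2 => if i.val + j.val + 1 = 2 then (1 : L) else 0))
            (c₁ • (Matrix.of fun i j : Fin 1 => if i.val + j.val + 1 = 1 then (1 : L) else 0))).map (algebraMap L (LocalRing L v)))
        (x : (cmDatum L (2 + 1) (finSum 2 1 (c₂ • (Matrix.of fun i j : Fin 2 => if i.val + j.val + 1 = 2 then (1 : L) else 0))
            (c₁ • (Matrix.of fun i j : Fin 1 => if i.val + j.val + 1 = 1 then (1 : L) else 0)))).Local v),
        IsUnit (a - (εH.2.val.val : Matrix (Fin 1) (Fin 1) (LocalRing L v)) 0 0) ∧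
        mat L (2 + 1) (finSum 2 1 (c₂ • (Matrix.of fun i j : Fin 2 => if i.val + j.val + 1 = 2 then (1 : L) else 0))
            (c₁ • (Matrix.of fun i j : Fin 1 => if i.val + j.val + 1 = 1 then (1 : L) else 0))) v x =
          finSum 2 1 (a • (1 : Matrix (Fin 2) (Fin 2) (LocalRing L v)))
            (((εH.2.val.val : Matrix (Fin 1) (Fin 1) (LocalRing L v)) 0 0) • (1 : Matrix (Fin 1) (Fin 1) (LocalRing L v))) ∧
        cmDatumLocalCongr L v T isUnit_one hT x = ε ∧
        ∀ (z : ((cmDatum L 2 (Matrix.of fun i j : Fin 2 => if i.val + j.val + 1 = 2 then (1 : L) else 0)).Local v ×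
            (cmDatum L 1 (Matrix.of fun i j : Fin 1 => if i.val + j.val + 1 = 1 then (1 : L) else 0)).Local v))
          (g : (cmDatum L (2 + 1) (finSum 2 1 (c₂ • (Matrix.of fun i j : Fin 2 => if i.val + j.val + 1 = 2 then (1 : L) else 0))
            (c₁ • (Matrix.of fun i j : Fin 1 => if i.val + j.val + 1 = 1 then (1 : L) else 0)))).Local v),
          mat L (2 + 1) (finSum 2 1 (c₂ • (Matrix.of fun i j : Fin 2 => if i.val + j.val + 1 = 2 then (1 : L) else 0))
              (c₁ • (Matrix.of fun i j : Fin 1 => if i.val + j.val + 1 = 1 then (1 : L) else 0))) v g =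
            finSum 2 1 (z.1.val.val : Matrix (Fin 2) (Fin 2) (LocalRing L v)) (z.2.val.val : Matrix (Fin 1) (Fin 1) (LocalRing L v)) →
          cmDatumLocalCongr L v T isUnit_one hT g = ((θ z).1 : (cmDatum L 3 H').Local v) := by
  classical
  -- (0) the field `L ⊗ L⁺_v = L_w`, its involution `σ`, the local form
  set σ := conjLocal L (IsCMField.complexConj L) v with hσdef
  have hF : IsField (LocalRing L v) := LocalRing.isField_of_smul_eq (IsCMField.complexConj L) (IsCMField.complexConj_ne_one L) w hw
  have hunit_of_ne : ∀ {t : LocalRing L v}, t ≠ 0 → IsUnit t := fun {t} ht => by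
    obtain ⟨s, hs⟩ := hF.mul_inv_cancel ht
    exact isUnit_iff_exists_inv.2 ⟨s, hs⟩
  obtain ⟨x₀, hx₀⟩ := Literature.NumberTheory.NumberFields.IsCMField.exists_complexConj_ne L
  have hcδ : IsCMField.complexConj L (x₀ - IsCMField.complexConj L x₀) = -(x₀ - IsCMField.complexConj L x₀) := by
    rw [map_sub, IsCMField.complexConj_apply_apply, neg_sub]
  have hδ : x₀ - IsCMField.complexConj L x₀ ≠ 0 := fun h => hx₀ (sub_eq_zero.1 h).symm
  have hσσ : ∀ s, σ (σ s) = s := Liu2021.LemD1OfPlace.conjLocal_conjLocal_apply L v (IsCMField.complexConj L) hcδ hδ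
  have hdet' : H'.det ≠ 0 := Godement.det_ne_zero_of_anisotropic L H' hanis
  have hHv : (((adelicForm L 3 H').map (adeleToLocal L v)).map σ)ᵀ = (adelicForm L 3 H').map (adeleToLocal L v) :=
    map_conjLocal_transpose_localForm L 3 H' v hherm
  have hHvd : IsUnit ((adelicForm L 3 H').map (adeleToLocal L v)).det := UnitaryGroup.isUnit_det_localForm L 3 H' v hdet'
  -- (1) ★ F3a: the Gram matrix of the conjugator `y`, then the swap `W`
  obtain ⟨lam, mu, hlamσ, hmuσ, hG⟩ := K2E3DockInvariantForm.exists_formCongr_dock_eq L H' v hherm (fun z => θ z) (fun t => t.1) y hθ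
  obtain ⟨W, hW, hWi⟩ := exists_units_swap (R := LocalRing L v)
  have hYW : formCongr σ (y * W) ((adelicForm L 3 H').map (adeleToLocal L v)) = finSum 2 1 !![0, lam; lam, 0] !![mu] := by
    have h1 : formCongr σ (y * W) ((adelicForm L 3 H').map (adeleToLocal L v)) =
        ((W.val).map σ)ᵀ * formCongr σ y ((adelicForm L 3 H').map (adeleToLocal L v)) * W.val := by
      simp only [formCongr, Units.val_mul, Matrix.map_mul, Matrix.transpose_mul, Matrix.mul_assoc]
    rw [h1, hG, hW, swap_conj_dockGram]
  obtain ⟨-, -, hG₁d, hmuu⟩ := blocks_of_twistGram_eq_finSum σ hσσ hHv hHvd (y * W) hYW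
  have hlamu : IsUnit lam := by
    rw [Matrix.det_fin_two_of] at hG₁d
    have h : IsUnit (-(lam * lam)) := by simpa using hG₁d
    exact isUnit_of_mul_isUnit_left (IsUnit.neg_iff _ |>.1 h)
  have hmuu' : IsUnit mu := by simpa using hmuu
  -- (2) the norm dichotomy on both blocks
  obtain ⟨s₂, c₂, hs₂u, hc₂0, hc₂c, hc₂⟩ := exists_unit_smul_eq_algebraMap L v w hw hunr hlamσ hlamu
  obtain ⟨s₁, c₁, hs₁u, hc₁0, hc₁c, hc₁⟩ := exists_unit_smul_eq_algebraMap L v w hw hunr hmuσ hmuu'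
  -- (3) the block-scalar change `S = (s₂·1) ⊕ᶠ (s₁·1)` and the frame `T = y·W·S`
  obtain ⟨S₁, s₂', hs₂', hS₁, hS₁i⟩ := exists_gl_val_eq_smul_one (R := LocalRing L v) 2 hs₂u
  obtain ⟨S₂, s₁', hs₁', hS₂, hS₂i⟩ := exists_gl_val_eq_smul_one (R := LocalRing L v) 1 hs₁u
  obtain ⟨S, hS, hSi⟩ := exists_gl_val_eq_finSum S₁ S₂
  have hYWf : formCongr σ (y * W) (H'.map (algebraMap L (LocalRing L v))) = finSum 2 1 !![0, lam; lam, 0] !![mu] := by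
    rw [← Literature.NumberTheory.Rogawski1990.adelicForm_map_adeleToLocal L v H']; exact hYW
  have hΦ₂ : formCongr σ S₁ !![0, lam; lam, 0] =
      (c₂ • (Matrix.of fun i j : Fin 2 => if i.val + j.val + 1 = 2 then (1 : L) else 0)).map (algebraMap L (LocalRing L v)) := by
    rw [formCongr_of_val_eq_smul_one σ S₁ hS₁]
    have e : σ s₂ * s₂ * lam = algebraMap L (LocalRing L v) c₂ := by rw [hc₂]; ring
    refine Matrix.ext fun i j => ?_
    fin_cases i <;> fin_cases j <;> simp [e]
  have hΦ₁ : formCongr σ S₂ !![mu] =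
      (c₁ • (Matrix.of fun i j : Fin 1 => if i.val + j.val + 1 = 1 then (1 : L) else 0)).map (algebraMap L (LocalRing L v)) := by
    rw [formCongr_of_val_eq_smul_one σ S₂ hS₂]
    have e : σ s₁ * s₁ * mu = algebraMap L (LocalRing L v) c₁ := by rw [hc₁]; ring
    refine Matrix.ext fun i j => ?_
    fin_cases i; fin_cases j; simp [e]
  obtain ⟨P, hP⟩ : ∃ P : GL (Fin (2 + 1)) (LocalRing L v), P = y * W := ⟨_, rfl⟩
  have hPf : formCongr σ P (H'.map (algebraMap L (LocalRing L v))) = finSum 2 1 !![0, lam; lam, 0] !![mu] := by rw [hP]; exact hYWf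
  have hT : formCongr σ (P * S) (H'.map (algebraMap L (LocalRing L v))) =
      (1 : LocalRing L v) • (finSum 2 1 (c₂ • (Matrix.of fun i j : Fin 2 => if i.val + j.val + 1 = 2 then (1 : L) else 0))
        (c₁ • (Matrix.of fun i j : Fin 1 => if i.val + j.val + 1 = 1 then (1 : L) else 0))).map (algebraMap L (LocalRing L v)) := by
    rw [one_smul, finSum_map, formCongr_mul_of_finSum σ _ P S S₁ S₂ hPf hS, hΦ₂, hΦ₁]
  -- (4) the point `x = φ_T⁻¹ ε` and its matrix
  have hyε : (ε.val : GL (Fin 3) (LocalRing L v)) = y * ((endoEmbLocal L v εH).val : GL (Fin 3) (LocalRing L v)) * y⁻¹ := by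
    have h := hθ εH
    rwa [hε] at h
  have hιε : ((endoEmbLocal L v εH).val.val : Matrix (Fin 3) (Fin 3) (LocalRing L v)) =
      W.val * finSum 2 1 (a • (1 : Matrix (Fin 2) (Fin 2) (LocalRing L v))) (εH.2.val.val : Matrix (Fin 1) (Fin 1) (LocalRing L v)) * W.val := by
    rw [coe_endoEmbLocal_eq_swap_mul_finSum_mul_swap L v εH, ha, hW]
  have hPε : ((y * W)⁻¹ * (ε.val : GL (Fin 3) (LocalRing L v)) * (y * W)).val =
      finSum 2 1 (a • (1 : Matrix (Fin 2) (Fin 2) (LocalRing L v))) (εH.2.val.val : Matrix (Fin 1) (Fin 1) (LocalRing L v)) := by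
    have h1 : (y * W)⁻¹ * (ε.val : GL (Fin 3) (LocalRing L v)) * (y * W) = W⁻¹ * ((endoEmbLocal L v εH).val : GL (Fin 3) (LocalRing L v)) * W := by
      rw [hyε]; group
    rw [h1, Units.val_mul, Units.val_mul, hWi]
    have h2 : (((endoEmbLocal L v εH).val : GL (Fin 3) (LocalRing L v)).val : Matrix (Fin 3) (Fin 3) (LocalRing L v)) =
        W.val * finSum 2 1 (a • (1 : Matrix (Fin 2) (Fin 2) (LocalRing L v))) (εH.2.val.val : Matrix (Fin 1) (Fin 1) (LocalRing L v)) * W.val := hιε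
    rw [h2, hW]
    have h3 : !![(1 : LocalRing L v), 0, 0; 0, 0, 1; 0, 1, 0] *
        (!![(1 : LocalRing L v), 0, 0; 0, 0, 1; 0, 1, 0] * finSum 2 1 (a • (1 : Matrix (Fin 2) (Fin 2) (LocalRing L v))) (εH.2.val.val : Matrix (Fin 1) (Fin 1) (LocalRing L v)) *
          !![(1 : LocalRing L v), 0, 0; 0, 0, 1; 0, 1, 0]) * !![(1 : LocalRing L v), 0, 0; 0, 0, 1; 0, 1, 0] =
        (!![(1 : LocalRing L v), 0, 0; 0, 0, 1; 0, 1, 0] * !![(1 : LocalRing L v), 0, 0; 0, 0, 1; 0, 1, 0]) *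
          finSum 2 1 (a • (1 : Matrix (Fin 2) (Fin 2) (LocalRing L v))) (εH.2.val.val : Matrix (Fin 1) (Fin 1) (LocalRing L v)) *
          (!![(1 : LocalRing L v), 0, 0; 0, 0, 1; 0, 1, 0] * !![(1 : LocalRing L v), 0, 0; 0, 0, 1; 0, 1, 0]) := by
      simp only [Matrix.mul_assoc]
    rw [h3, swap_mul_swap, Matrix.one_mul, Matrix.mul_one]
  obtain ⟨x, hx⟩ : ∃ x : (cmDatum L (2 + 1) _).Local v, cmDatumLocalCongr L v (P * S) isUnit_one hT x = ε :=
    ⟨_, (cmDatumLocalCongr L v (P * S) isUnit_one hT).apply_symm_apply ε⟩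
  obtain ⟨e, he⟩ : ∃ e : GL (Fin (2 + 1)) (LocalRing L v), e = ε.val := ⟨_, rfl⟩
  have hconj : (P * S) * x.val * (P * S)⁻¹ = e := by
    rw [← coe_cmDatumLocalCongr_apply L v (P * S) isUnit_one hT x, he]
    exact congrArg Subtype.val hx
  have h2 : P * S * x.val = e * (P * S) := mul_inv_eq_iff_eq_mul.1 hconj
  have hx1' : x.val = (P * S)⁻¹ * (e * (P * S)) := eq_inv_mul_iff_mul_eq.2 h2
  have hx1 : x.val = S⁻¹ * (P⁻¹ * e * P) * S := by
    rw [hx1', _root_.mul_inv_rev]; simp only [mul_assoc]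
  have hPe : (P⁻¹ * e * P).val =
      finSum 2 1 (a • (1 : Matrix (Fin 2) (Fin 2) (LocalRing L v))) (εH.2.val.val : Matrix (Fin 1) (Fin 1) (LocalRing L v)) := by
    rw [hP, he]; exact hPε
  refine ⟨c₂, c₁, hc₂0, hc₁0, hc₂c, hc₁c, P * S, hT, x, hunit_of_ne (sub_ne_zero.2 hu.symm), ?_, hx, fun z g hg => ?_⟩
  · -- the matrix of `x`: `S⁻¹·W·(y⁻¹ ε y)·W·S = a·1 ⊕ᶠ u·1`
    rw [mat_def, hx1, Units.val_mul, Units.val_mul, hPe, finSum_inv_mul_scalar_mul S S₁ S₂ hS hSi, ← fin_one_eq_smul_one]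
  · -- the intertwining `φ_T g = ↑(θ z)` for `mat g = mat z.1 ⊕ᶠ mat z.2`
    apply Subtype.ext
    rw [coe_cmDatumLocalCongr_apply L v (P * S) isUnit_one hT g, hθ z, hP]
    apply Units.ext
    have hgm : (g.val : GL (Fin (2 + 1)) (LocalRing L v)).val =
        finSum 2 1 (z.1.val.val : Matrix (Fin 2) (Fin 2) (LocalRing L v)) (z.2.val.val : Matrix (Fin 1) (Fin 1) (LocalRing L v)) := by
      rw [← mat_def]; exact hg
    have hιz : (((endoEmbLocal L v z).val : GL (Fin 3) (LocalRing L v)).val : Matrix (Fin 3) (Fin 3) (LocalRing L v)) =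
        W.val * finSum 2 1 (z.1.val.val : Matrix (Fin 2) (Fin 2) (LocalRing L v)) (z.2.val.val : Matrix (Fin 1) (Fin 1) (LocalRing L v)) * W.val := by
      rw [hW]; exact coe_endoEmbLocal_eq_swap_mul_finSum_mul_swap L v z
    have hSc : S.val * finSum 2 1 (z.1.val.val : Matrix (Fin 2) (Fin 2) (LocalRing L v)) (z.2.val.val : Matrix (Fin 1) (Fin 1) (LocalRing L v)) * (S⁻¹).val =
        finSum 2 1 (z.1.val.val : Matrix (Fin 2) (Fin 2) (LocalRing L v)) (z.2.val.val : Matrix (Fin 1) (Fin 1) (LocalRing L v)) := by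
      rw [hS, hSi, hS₁, hS₂, hS₁i, hS₂i]
      exact finSum_smul_one_mul_finSum_mul hs₂' hs₁' _ _
    simp only [Units.val_mul, _root_.mul_inv_rev]
    rw [hgm, hιz]
    calc y.val * W.val * S.val * finSum 2 1 (z.1.val.val : Matrix (Fin 2) (Fin 2) (LocalRing L v)) (z.2.val.val : Matrix (Fin 1) (Fin 1) (LocalRing L v)) *
          ((S⁻¹).val * ((W⁻¹).val * (y⁻¹).val))
        = y.val * W.val * (S.val * finSum 2 1 (z.1.val.val : Matrix (Fin 2) (Fin 2) (LocalRing L v)) (z.2.val.val : Matrix (Fin 1) (Fin 1) (LocalRing L v)) * (S⁻¹).val) *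
          (W⁻¹).val * (y⁻¹).val := by simp only [Matrix.mul_assoc]
      _ = y.val * (W.val * finSum 2 1 (z.1.val.val : Matrix (Fin 2) (Fin 2) (LocalRing L v)) (z.2.val.val : Matrix (Fin 1) (Fin 1) (LocalRing L v)) * W.val) * (y⁻¹).val := by
          rw [hSc, hWi, ← hW]; simp only [Matrix.mul_assoc]

end Summit.HodgeConjecture.HodgeConjecture.Cruxes.H413.K2E3DockBlockModelInert

end
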